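import Mathlib
import Literature.Computability.Complexity.RangeAvoidance

/-!
# F-N2a core (pnp-ideate-p3 ROUND-17, Prop. B): the star-load certificate for pure `MAJ_k`-local maps

For a pure `MAJ_k` instance (`k` odd) and target signs `Y ∈ {±1}^m`: if the signed star loads
`D_v(Y) = Σ_{(j,i) : vars j i = v} Y_j` satisfy `Σ_v |D_v(Y)| < m`, then the bit-string `y_j = [Y_j = -1]`
is outside the range.  (A preimage `x` forces `Y_j · Σ_i X_{vars j i} ≥ 1` per output, summing to
`m ≤ Σ_v X_v D_v ≤ Σ_v |D_v|`.)  FRONTIER; nothing here bears on P vs NP.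
-/

namespace Summit.PneNP.PneNP.Theorems.LtfLocalAvoidCore

open Literature.Computability.Complexity Finset

/-- `MAJ_k` on bits: `true` iff strictly more than half of the `k` arguments are `true`. -/
def majPred (k : ℕ) (u : Fin k → Bool) : Bool :=
  decide (k < 2 * (Finset.univ.filter fun i => u i = true).card)

/-- Signed star load of position `v` under the sign vector `Y` (with multiplicity). -/
def starLoad {k n m : ℕ} (I : LocalMap k n m) (Y : Fin m → ℤ) (v : Fin n) : ℤ :=
  ∑ j : Fin m, ∑ i : Fin k, if I.vars j i = v then Y j else 0

/-- `±1` reading of a bit: `false ↦ 1`, `true ↦ -1`. -/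
def sgnZ (b : Bool) : ℤ := if b then -1 else 1

/-- `|sgn b| = 1`. -/
lemma abs_sgnZ (b : Bool) : |sgnZ b| = 1 := by cases b <;> simp [sgnZ]

/-- The sum of the signs of a bit-vector is `k − 2·#true`. -/
lemma sum_sgnZ_eq (k : ℕ) (u : Fin k → Bool) :
    ∑ i : Fin k, sgnZ (u i) = (k : ℤ) - 2 * ((Finset.univ.filter fun i => u i = true).card : ℤ) := by
  have h : ∀ i, sgnZ (u i) = 1 - 2 * (if u i = true then (1:ℤ) else 0) := by
    intro i; cases u i <;> simp [sgnZ]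
  simp_rw [h]
  rw [Finset.sum_sub_distrib, ← Finset.mul_sum, Finset.sum_boole]
  simp

/-- Per-output inequality: with `k` odd, `MAJ_k(u) = [Y = -1]` forces `Y · Σ_i sgn(u_i) ≥ 1`. -/
lemma one_le_mul_sum_sgnZ (k : ℕ) (hk : Odd k) (u : Fin k → Bool) (Yj : ℤ) (hY : Yj = 1 ∨ Yj = -1)
    (h : majPred k u = decide (Yj = -1)) : 1 ≤ Yj * ∑ i, sgnZ (u i) := by
  rw [sum_sgnZ_eq]
  obtain ⟨r, hr⟩ := hk
  set c : ℕ := (Finset.univ.filter fun i => u i = true).card with hc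
  rcases hY with rfl | rfl
  · have h' : ¬ k < 2 * c := by simpa [majPred] using h
    omega
  · have h' : k < 2 * c := by simpa [majPred] using h
    omega

/-- Exchange of summation: `Σ_j Y_j Σ_i X_{vars j i} = Σ_v X_v · D_v(Y)`. -/
lemma sum_outputs_eq_sum_loads {k n m : ℕ} (I : LocalMap k n m) (Y : Fin m → ℤ) (X : Fin n → ℤ) :
    ∑ j : Fin m, Y j * ∑ i : Fin k, X (I.vars j i) = ∑ v : Fin n, X v * starLoad I Y v := by
  have key : ∀ j i, Y j * X (I.vars j i) = ∑ v : Fin n, X v * (if I.vars j i = v then Y j else 0) := by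
    intro j i
    simp_rw [mul_ite, mul_zero]
    rw [Finset.sum_ite_eq]
    simp [mul_comm]
  calc ∑ j : Fin m, Y j * ∑ i : Fin k, X (I.vars j i)
      = ∑ j : Fin m, ∑ i : Fin k, Y j * X (I.vars j i) := by simp_rw [Finset.mul_sum]
    _ = ∑ j : Fin m, ∑ i : Fin k, ∑ v : Fin n, X v * (if I.vars j i = v then Y j else 0) := by
        simp_rw [key]
    _ = ∑ j : Fin m, ∑ v : Fin n, ∑ i : Fin k, X v * (if I.vars j i = v then Y j else 0) := by
        refine Finset.sum_congr rfl fun j _ => Finset.sum_comm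
    _ = ∑ v : Fin n, ∑ j : Fin m, ∑ i : Fin k, X v * (if I.vars j i = v then Y j else 0) :=
        Finset.sum_comm
    _ = ∑ v : Fin n, X v * starLoad I Y v := by simp_rw [starLoad, Finset.mul_sum]

/-- **F-N2a core for pure `MAJ_k`, `k` odd**: a sign vector with total star load below `m` certifies
that its bit-string is outside the range. -/
theorem not_mem_range_of_starLoad_lt {k n m : ℕ} (hk : Odd k) (I : LocalMap k n m)
    (hI : I.IsPure (majPred k)) (Y : Fin m → ℤ) (hY : ∀ j, Y j = 1 ∨ Y j = -1)
    (hD : ∑ v : Fin n, |starLoad I Y v| < (m : ℤ)) :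
    (fun j => decide (Y j = -1)) ∉ I.range := by
  rintro ⟨x, hx⟩
  have hout : ∀ j, majPred k (fun i => x (I.vars j i)) = decide (Y j = -1) := by
    intro j
    have := congrFun hx j
    simpa [LocalMap.eval, hI.1 j] using this
  have h1 : ∀ j, (1:ℤ) ≤ Y j * ∑ i, sgnZ (x (I.vars j i)) := fun j =>
    one_le_mul_sum_sgnZ k hk _ (Y j) (hY j) (hout j)
  have hm : (m : ℤ) ≤ ∑ j : Fin m, Y j * ∑ i, sgnZ (x (I.vars j i)) := by
    calc (m : ℤ) = ∑ _j : Fin m, (1:ℤ) := by simp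
      _ ≤ _ := Finset.sum_le_sum fun j _ => h1 j
  rw [sum_outputs_eq_sum_loads I Y (fun v => sgnZ (x v))] at hm
  have hle : ∑ v : Fin n, sgnZ (x v) * starLoad I Y v ≤ ∑ v : Fin n, |starLoad I Y v| :=
    Finset.sum_le_sum fun v _ => by
      calc sgnZ (x v) * starLoad I Y v ≤ |sgnZ (x v) * starLoad I Y v| := le_abs_self _
        _ = |sgnZ (x v)| * |starLoad I Y v| := abs_mul _ _
        _ = |starLoad I Y v| := by rw [abs_sgnZ, one_mul]
  omega

/-! ### The greedy potential signing: a sign vector with `(Σ_v |D_v|)² ≤ k²·n·m` always exists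
(and is computed by one pass over the outputs). -/

section Greedy

variable {k n m : ℕ}

/-- Multiplicity of position `v` among the `k` positions of output `j`. -/
def mult (I : LocalMap k n m) (j : Fin m) (v : Fin n) : ℤ :=
  ∑ i : Fin k, if I.vars j i = v then 1 else 0

/-- Multiplicities are nonnegative. -/
lemma mult_nonneg (I : LocalMap k n m) (j : Fin m) (v : Fin n) : 0 ≤ mult I j v :=
  Finset.sum_nonneg fun i _ => by split_ifs <;> norm_num

/-- The multiplicities of one output sum to `k`. -/
lemma sum_mult (I : LocalMap k n m) (j : Fin m) : ∑ v : Fin n, mult I j v = k := by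
  unfold mult
  rw [Finset.sum_comm]
  simp [Finset.sum_ite_eq]

/-- Each multiplicity is at most `k`. -/
lemma mult_le (I : LocalMap k n m) (j : Fin m) (v : Fin n) : mult I j v ≤ k := by
  rw [← sum_mult I j]
  exact Finset.single_le_sum (fun w _ => mult_nonneg I j w) (Finset.mem_univ v)

/-- `Σ_v mult² ≤ k²`. -/
lemma sum_mult_sq_le (I : LocalMap k n m) (j : Fin m) : ∑ v : Fin n, (mult I j v) ^ 2 ≤ (k : ℤ) ^ 2 := by
  calc ∑ v : Fin n, (mult I j v) ^ 2 = ∑ v : Fin n, mult I j v * mult I j v := by simp_rw [sq]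
    _ ≤ ∑ v : Fin n, mult I j v * k :=
        Finset.sum_le_sum fun v _ => mul_le_mul_of_nonneg_left (mult_le I j v) (mult_nonneg I j v)
    _ = (k : ℤ) ^ 2 := by rw [← Finset.sum_mul, sum_mult, sq]

/-- The sign chosen against the current correlation. -/
def pickSign (corr : ℤ) : ℤ := if 0 < corr then -1 else 1

/-- `pickSign` is `±1`. -/
lemma pickSign_cases (c : ℤ) : pickSign c = 1 ∨ pickSign c = -1 := by
  unfold pickSign; split_ifs <;> simp

/-- The picked sign anti-correlates: `pickSign c · c ≤ 0`. -/
lemma pickSign_mul_nonpos (c : ℤ) : pickSign c * c ≤ 0 := by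
  unfold pickSign; split_ifs with h <;> nlinarith

/-- `pickSign c ^ 2 = 1`. -/
lemma pickSign_sq (c : ℤ) : pickSign c ^ 2 = 1 := by
  rcases pickSign_cases c with h | h <;> simp [h]

/-- Loads after greedily signing the first `t` outputs. -/
def greedyAux (I : LocalMap k n m) : ℕ → (Fin n → ℤ)
  | 0 => fun _ => 0
  | t + 1 =>
      if h : t < m then
        fun v => greedyAux I t v +
          pickSign (∑ w : Fin n, greedyAux I t w * mult I ⟨t, h⟩ w) * mult I ⟨t, h⟩ v
      else greedyAux I t

/-- The greedy sign of output `j` (depends on the loads created by the outputs before it). -/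
def greedySign (I : LocalMap k n m) (j : Fin m) : ℤ :=
  pickSign (∑ w : Fin n, greedyAux I j.val w * mult I j w)

/-- Greedy signs are `±1`. -/
lemma greedySign_cases (I : LocalMap k n m) (j : Fin m) : greedySign I j = 1 ∨ greedySign I j = -1 :=
  pickSign_cases _

/-- One greedy step. -/
lemma greedyAux_succ (I : LocalMap k n m) (t : ℕ) (h : t < m) (v : Fin n) :
    greedyAux I (t + 1) v = greedyAux I t v + greedySign I ⟨t, h⟩ * mult I ⟨t, h⟩ v := by
  simp [greedyAux, h, greedySign]

/-- Potential bound: `Σ_v (load after t steps)² ≤ k² · t`. -/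
lemma potential_le (I : LocalMap k n m) : ∀ t, t ≤ m →
    ∑ v : Fin n, (greedyAux I t v) ^ 2 ≤ (k : ℤ) ^ 2 * t := by
  intro t
  induction t with
  | zero => intro _; simp [greedyAux]
  | succ t ih =>
      intro ht
      have h : t < m := Nat.lt_of_succ_le ht
      have ih' := ih h.le
      set a := greedyAux I t with ha
      set c := mult I ⟨t, h⟩ with hc
      set s := greedySign I ⟨t, h⟩ with hs
      have hstep : ∀ v, greedyAux I (t + 1) v = a v + s * c v := fun v => greedyAux_succ I t h v
      simp_rw [hstep]
      have hexp : ∑ v : Fin n, (a v + s * c v) ^ 2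
          = ∑ v : Fin n, (a v) ^ 2 + 2 * (s * ∑ v : Fin n, a v * c v) + s ^ 2 * ∑ v : Fin n, (c v) ^ 2 := by
        rw [Finset.mul_sum, Finset.mul_sum, Finset.mul_sum, ← Finset.sum_add_distrib, ← Finset.sum_add_distrib]
        refine Finset.sum_congr rfl fun v _ => by ring
      have hcorr : s * ∑ v : Fin n, a v * c v ≤ 0 := by
        rw [hs, greedySign]; exact pickSign_mul_nonpos _
      have hs2 : s ^ 2 = 1 := by rw [hs, greedySign]; exact pickSign_sq _
      have hc2 : ∑ v : Fin n, (c v) ^ 2 ≤ (k : ℤ) ^ 2 := sum_mult_sq_le I ⟨t, h⟩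
      rw [hexp, hs2, one_mul]
      push_cast
      nlinarith

/-- The greedy loads are the star loads of the greedy sign vector. -/
lemma greedyAux_eq_sum (I : LocalMap k n m) : ∀ t, t ≤ m → ∀ v,
    greedyAux I t v = ∑ j : Fin m, if j.val < t then greedySign I j * mult I j v else 0 := by
  intro t
  induction t with
  | zero => intro _ v; simp [greedyAux]
  | succ t ih =>
      intro ht v
      have h : t < m := Nat.lt_of_succ_le ht
      rw [greedyAux_succ I t h v, ih h.le v]
      have hsplit : ∀ j : Fin m, (if j.val < t + 1 then greedySign I j * mult I j v else 0)
          = (if j.val < t then greedySign I j * mult I j v else 0)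
            + (if j = ⟨t, h⟩ then greedySign I j * mult I j v else 0) := by
        intro j
        by_cases hj : j.val < t
        · have hne : j ≠ ⟨t, h⟩ := fun e => by simp [e] at hj
          simp [hj, hne, Nat.lt_succ_of_lt hj]
        · by_cases hj' : j = ⟨t, h⟩
          · subst hj'; simp
          · have : ¬ j.val < t + 1 := fun e => by
              rcases Nat.lt_succ_iff_lt_or_eq.mp e with e | e
              · exact hj e
              · exact hj' (Fin.ext e)
            simp [hj, hj', this]
      simp_rw [hsplit, Finset.sum_add_distrib, Finset.sum_ite_eq']
      simp

/-- The final greedy loads are the star loads of the greedy sign vector. -/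
lemma starLoad_greedy (I : LocalMap k n m) (v : Fin n) :
    starLoad I (greedySign I) v = greedyAux I m v := by
  rw [greedyAux_eq_sum I m le_rfl v]
  unfold starLoad mult
  refine Finset.sum_congr rfl fun j _ => ?_
  simp only [j.isLt, if_true]
  rw [Finset.mul_sum]
  refine Finset.sum_congr rfl fun i _ => ?_
  split_ifs <;> simp

/-- **Greedy star bound**: `(Σ_v |D_v(Y)|)² ≤ k² · n · m` for the greedy sign vector `Y`. -/
theorem greedy_starLoad_sq_le (I : LocalMap k n m) :
    (∑ v : Fin n, |starLoad I (greedySign I) v|) ^ 2 ≤ (k : ℤ) ^ 2 * n * m := by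
  have hcs : (∑ v : Fin n, |starLoad I (greedySign I) v|) ^ 2
      ≤ (∑ _v : Fin n, (1:ℤ) ^ 2) * ∑ v : Fin n, |starLoad I (greedySign I) v| ^ 2 := by
    have := Finset.sum_mul_sq_le_sq_mul_sq (Finset.univ : Finset (Fin n))
      (fun _ => (1:ℤ)) (fun v => |starLoad I (greedySign I) v|)
    simpa using this
  have hpot : ∑ v : Fin n, |starLoad I (greedySign I) v| ^ 2 ≤ (k : ℤ) ^ 2 * m := by
    simp_rw [sq_abs, starLoad_greedy]
    exact potential_le I m le_rfl
  have hn : (∑ _v : Fin n, (1:ℤ) ^ 2) = n := by simp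
  rw [hn] at hcs
  calc _ ≤ (n : ℤ) * ∑ v : Fin n, |starLoad I (greedySign I) v| ^ 2 := hcs
    _ ≤ (n : ℤ) * ((k : ℤ) ^ 2 * m) := mul_le_mul_of_nonneg_left hpot (by positivity)
    _ = (k : ℤ) ^ 2 * n * m := by ring

/-- The explicit answer: the greedy bit-string. -/
def greedyBits (I : LocalMap k n m) : Fin m → Bool := fun j => decide (greedySign I j = -1)

/-- **F-N2a, pure `MAJ_k` (k odd), combinatorial form**: at stretch `m > k²·n` the greedy bit-string is
outside the range of every pure `MAJ_k`-local map.  (Polynomial time of the one-pass computation is the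
separate FP wrapper.) -/
theorem greedyBits_not_mem_range (hk : Odd k) (I : LocalMap k n m) (hI : I.IsPure (majPred k))
    (hm : k ^ 2 * n < m) : greedyBits I ∉ I.range := by
  apply not_mem_range_of_starLoad_lt hk I hI (greedySign I) (greedySign_cases I)
  have hsq := greedy_starLoad_sq_le I
  have hm' : (k : ℤ) ^ 2 * n * m < (m : ℤ) * m := by
    have : ((k ^ 2 * n : ℕ) : ℤ) < m := by exact_mod_cast hm
    push_cast at this
    have hmpos : (0 : ℤ) < m := by
      have : 0 < m := lt_of_le_of_lt (Nat.zero_le _) hm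
      exact_mod_cast this
    nlinarith
  have hnonneg : 0 ≤ ∑ v : Fin n, |starLoad I (greedySign I) v| :=
    Finset.sum_nonneg fun v _ => abs_nonneg _
  nlinarith

end Greedy

end Summit.PneNP.PneNP.Theorems.LtfLocalAvoidCore
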